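import Summits.QuantumAdvantage.QuantumAdvantage.Theorems.NullTwistB

/-! # NullTwist — part 3/3 (mechanical split for landing of `NullTwist`; content verbatim; scopes re-opened with their variables) -/

set_option linter.dupNamespace false

namespace Summit.QuantumAdvantage.AdviceFreeQNC0.NullTwist
open Classical
open Finset
open Summit.QuantumAdvantage.AdviceFreeQNC0
open Summit.QuantumAdvantage.AdviceFreeQNC0.RegisterRotation
open Literature.Computability.MetaComplexity Literature.Computability.MetaComplexity.Smolensky
variable {n : ℕ}

section Fibre

/-- counted over an a.e.-null twist: the fibrewise-smooth win set (with the shifted family) loses at most the exceptional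
set `{u : WIN_c(z)(u)}` of `z`. -/
theorem card_fibreWin_twist_ae_null (c : ℕ) (y z : Fin (n + 1) → (Fin n → Bool) → Bool)
    (F : Fin 3 → (Fin n → Bool) → Bool) :
    (univ.filter fun u : Fin n → Bool => fibreWin c y F u = true).card ≤
      (univ.filter fun u : Fin n → Bool =>
          fibreWin c (xorStrat y z) (fun j v => Bool.xor (F j v) (ringWinU (c + 1) z v)) u = true).card +
        (univ.filter fun u : Fin n → Bool => ringWinU c z u = true).card := by
  refine le_trans (Finset.card_le_card fun u hu => ?_) (Finset.card_union_le _ _)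
  rw [Finset.mem_filter] at hu
  rw [Finset.mem_union, Finset.mem_filter, Finset.mem_filter]
  cases hz : ringWinU c z u
  · left; exact ⟨Finset.mem_univ _, by rw [fibreWin_twist_of_null c y z F u hz]; exact hu.2⟩
  · right; exact ⟨Finset.mem_univ _, rfl⟩

/-- the generic element of the boundary null-twist MODULE: `modTw c t := nullTw c 0 t₀ ⊕ nullTw c 1 t₁ ⊕ nullTw c 2 t₂` for three
arbitrary tests (position-INdependent cuts `{0,1,n−1,n}`, input-DEPENDENT gates). -/
def modTw (c : ℕ) (t : Fin 3 → (Fin n → Bool) → Bool) : Fin (n + 1) → (Fin n → Bool) → Bool :=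
  xorStrat (xorStrat (nullTw c 0 (t 0)) (nullTw c 1 (t 1))) (nullTw c 2 (t 2))

/-- NullTwist helper `xorStrat_assoc` (decomp-qadv land package; see the module docstring). -/
theorem xorStrat_assoc (y y' y'' : Fin (n + 1) → (Fin n → Bool) → Bool) :
    xorStrat (xorStrat y y') y'' = xorStrat y (xorStrat y' y'') := by
  funext g u; unfold xorStrat; cases y g u <;> cases y' g u <;> cases y'' g u <;> rfl

/-- every module element is EXACTLY null at charge `c` … -/
theorem ringWinU_modTw (hn : 1 ≤ n) (c : ℕ) (t : Fin 3 → (Fin n → Bool) → Bool) (u : Fin n → Bool) :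
    ringWinU c (modTw c t) u = false := by
  unfold modTw
  rw [ringWinU_xorStrat, ringWinU_xorStrat, ringWinU_nullTw hn, ringWinU_nullTw hn, ringWinU_nullTw hn]; rfl

/-- … with side effect `⊕_k (t_k ∧ [wt ≢ −k (mod 3)])` — a generic element of `span{[wt ≡ j (3)]}·(low degree)`. -/
theorem ringWinU_modTw_succ (hn : 1 ≤ n) (c : ℕ) (t : Fin 3 → (Fin n → Bool) → Bool) (u : Fin n → Bool) :
    ringWinU (c + 1) (modTw c t) u =
      Bool.xor (Bool.xor (t 0 u && !decide ((0 + wt u) % 3 = 0)) (t 1 u && !decide ((1 + wt u) % 3 = 0)))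
        (t 2 u && !decide ((2 + wt u) % 3 = 0)) := by
  unfold modTw
  rw [ringWinU_xorStrat, ringWinU_xorStrat, ringWinU_nullTw_succ hn, ringWinU_nullTw_succ hn, ringWinU_nullTw_succ hn]

/-- NullTwist helper `hasDegF_modTw` (decomp-qadv land package; see the module docstring). -/
theorem hasDegF_modTw {p : ℕ} [Fact p.Prime] {d : ℕ} (c : ℕ) {t : Fin 3 → (Fin n → Bool) → Bool}
    (ht : ∀ k, HasDegF p (t k) d) (g : Fin (n + 1)) : HasDegF p (modTw c t g) (3 * (4 * (d + 1))) := by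
  have h := hasDegF_xorStrat (hasDegF_xorStrat (hasDegF_nullTw c 0 (ht 0)) (hasDegF_nullTw c 1 (ht 1)))
    (hasDegF_nullTw c 2 (ht 2)) g
  unfold HasDegF at h ⊢; exact lowDeg_mono (by omega) h

/-- **MODULE COVARIANCE of fibrewise smoothness**: twisting by ANY element `modTw c t` of the boundary null-twist module
maps a fibrewise witness family `F` to the explicit fibrewise family `F_j ⊕ ⊕_k (t_k ∧ [k + j ≢ 0 (3)])` (degrees
`+ 3·deg t + O(1)`), preserving `fibreWin` pointwise — no module element replays the collapse of §2 fibrewise. -/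
theorem fibreWin_modTw (hn : 1 ≤ n) (c : ℕ) (y : Fin (n + 1) → (Fin n → Bool) → Bool)
    (t : Fin 3 → (Fin n → Bool) → Bool) (F : Fin 3 → (Fin n → Bool) → Bool) (u : Fin n → Bool) :
    fibreWin c (xorStrat y (modTw c t))
      (fun j v => Bool.xor (Bool.xor (Bool.xor (F j v) (t 0 v && !decide ((0 + j.val) % 3 = 0)))
        (t 1 v && !decide ((1 + j.val) % 3 = 0))) (t 2 v && !decide ((2 + j.val) % 3 = 0))) u = fibreWin c y F u := by
  unfold modTw
  rw [← xorStrat_assoc, ← xorStrat_assoc,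
    fibreWin_nullTw hn c 2 (xorStrat (xorStrat y (nullTw c 0 (t 0))) (nullTw c 1 (t 1))) (t 2)
      (fun j v => Bool.xor (Bool.xor (F j v) (t 0 v && !decide ((0 + j.val) % 3 = 0)))
        (t 1 v && !decide ((1 + j.val) % 3 = 0))) u,
    fibreWin_nullTw hn c 1 (xorStrat y (nullTw c 0 (t 0))) (t 1)
      (fun j v => Bool.xor (F j v) (t 0 v && !decide ((0 + j.val) % 3 = 0))) u,
    fibreWin_nullTw hn c 0 y (t 0) F u]

/-- the witness-count form: a module twist moves NO input in or out of the fibrewise-smooth win set (with the re-indexed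
family), hence `FibreableAt`-witnesses transport along the whole module. -/
theorem card_fibreWin_modTw (hn : 1 ≤ n) (c : ℕ) (y : Fin (n + 1) → (Fin n → Bool) → Bool)
    (t : Fin 3 → (Fin n → Bool) → Bool) (F : Fin 3 → (Fin n → Bool) → Bool) :
    (univ.filter fun u : Fin n → Bool => fibreWin c (xorStrat y (modTw c t))
      (fun j v => Bool.xor (Bool.xor (Bool.xor (F j v) (t 0 v && !decide ((0 + j.val) % 3 = 0)))
        (t 1 v && !decide ((1 + j.val) % 3 = 0))) (t 2 v && !decide ((2 + j.val) % 3 = 0))) u = true).card =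
    (univ.filter fun u : Fin n → Bool => fibreWin c y F u = true).card :=
  congrArg Finset.card (Finset.filter_congr fun u _ => by rw [fibreWin_modTw hn])

/-- **DEFIBRING**: XOR `y` with the three twists gated by `F₀, F₁, F₂` — the win set is unchanged and the side pattern
becomes the UNIFORM test `F₀ ⊕ F₁ ⊕ F₂` exactly where it was `F_{wt mod 3}`. -/
def defib (c : ℕ) (y : Fin (n + 1) → (Fin n → Bool) → Bool) (F : Fin 3 → (Fin n → Bool) → Bool) :
    Fin (n + 1) → (Fin n → Bool) → Bool :=
  xorStrat (xorStrat (xorStrat y (nullTw c 0 (F 0))) (nullTw c 2 (F 1))) (nullTw c 1 (F 2))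

/-- NullTwist helper `ringWinU_defib` (decomp-qadv land package; see the module docstring). -/
theorem ringWinU_defib (hn : 1 ≤ n) (c : ℕ) (y : Fin (n + 1) → (Fin n → Bool) → Bool)
    (F : Fin 3 → (Fin n → Bool) → Bool) (u : Fin n → Bool) : ringWinU c (defib c y F) u = ringWinU c y u := by
  unfold defib
  rw [ringWinU_xorStrat, ringWinU_xorStrat, ringWinU_xorStrat, ringWinU_nullTw hn, ringWinU_nullTw hn,
    ringWinU_nullTw hn, Bool.xor_false, Bool.xor_false, Bool.xor_false]

/-- NullTwist helper `smoothWin_defib` (decomp-qadv land package; see the module docstring). -/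
theorem smoothWin_defib (hn : 1 ≤ n) (c : ℕ) (y : Fin (n + 1) → (Fin n → Bool) → Bool)
    (F : Fin 3 → (Fin n → Bool) → Bool) (u : Fin n → Bool) :
    smoothWin c (defib c y F) (fun v => Bool.xor (Bool.xor (F 0 v) (F 1 v)) (F 2 v)) u = fibreWin c y F u := by
  unfold smoothWin fibreWin
  dsimp only
  rw [ringWinU_defib hn]
  unfold defib
  rw [ringWinU_xorStrat, ringWinU_xorStrat, ringWinU_xorStrat, ringWinU_nullTw_succ hn, ringWinU_nullTw_succ hn,
    ringWinU_nullTw_succ hn, Nat.zero_add]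
  obtain hr | hr | hr : wt u % 3 = 0 ∨ wt u % 3 = 1 ∨ wt u % 3 = 2 := by omega
  · rw [wtCls_eq_zero hr, decide_eq_true hr, decide_eq_false (show ¬ (2 + wt u) % 3 = 0 by omega),
      decide_eq_false (show ¬ (1 + wt u) % 3 = 0 by omega)]
    cases ringWinU c y u <;> cases ringWinU (c + 1) y u <;> cases F 0 u <;> cases F 1 u <;> cases F 2 u <;> rfl
  · rw [wtCls_eq_one hr, decide_eq_false (show ¬ wt u % 3 = 0 by omega),
      decide_eq_true (show (2 + wt u) % 3 = 0 by omega), decide_eq_false (show ¬ (1 + wt u) % 3 = 0 by omega)]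
    cases ringWinU c y u <;> cases ringWinU (c + 1) y u <;> cases F 0 u <;> cases F 1 u <;> cases F 2 u <;> rfl
  · rw [wtCls_eq_two hr, decide_eq_false (show ¬ wt u % 3 = 0 by omega),
      decide_eq_false (show ¬ (2 + wt u) % 3 = 0 by omega), decide_eq_true (show (1 + wt u) % 3 = 0 by omega)]
    cases ringWinU c y u <;> cases ringWinU (c + 1) y u <;> cases F 0 u <;> cases F 1 u <;> cases F 2 u <;> rfl

/-- NullTwist helper `hasDegF_defib` (decomp-qadv land package; see the module docstring). -/
theorem hasDegF_defib {p : ℕ} [Fact p.Prime] {d d' : ℕ} (c : ℕ) {y : Fin (n + 1) → (Fin n → Bool) → Bool}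
    {F : Fin 3 → (Fin n → Bool) → Bool} (hy : ∀ g, HasDegF p (y g) d) (hF : ∀ j, HasDegF p (F j) d')
    (g : Fin (n + 1)) : HasDegF p (defib c y F g) (d + 3 * (4 * (d' + 1))) := by
  have h := hasDegF_xorStrat (hasDegF_xorStrat (hasDegF_xorStrat hy (hasDegF_nullTw c 0 (hF 0)))
    (hasDegF_nullTw c 2 (hF 1))) (hasDegF_nullTw c 1 (hF 2)) g
  unfold defib
  unfold HasDegF at h ⊢
  exact lowDeg_mono (by omega) h

/-- NullTwist helper `hasDegF_xor3` (decomp-qadv land package; see the module docstring). -/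
theorem hasDegF_xor3 {p : ℕ} [Fact p.Prime] {d : ℕ} {F : Fin 3 → (Fin n → Bool) → Bool}
    (hF : ∀ j, HasDegF p (F j) d) : HasDegF p (fun v => Bool.xor (Bool.xor (F 0 v) (F 1 v)) (F 2 v)) (3 * d) := by
  have h := RigidityLaws.hasDegF_xor (RigidityLaws.hasDegF_xor (hF 0) (hF 1)) (hF 2)
  unfold HasDegF at h ⊢
  exact lowDeg_mono (by omega) h

/-- NullTwist helper `polylog_step13` (decomp-qadv land package; see the module docstring). -/
theorem polylog_step13 {n : ℕ} (hn : 32 ≤ n) (C : ℕ) :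
    (Nat.log 2 n) ^ C + 3 * (4 * ((Nat.log 2 n) ^ C + 1)) ≤ (Nat.log 2 n) ^ (C + 2) ∧
      3 * (Nat.log 2 n) ^ C ≤ (Nat.log 2 n) ^ (C + 2) := by
  have h5 := five_le_log_of_le hn
  have h1 : 1 ≤ (Nat.log 2 n) ^ C := Nat.one_le_pow _ _ (by omega)
  have e : (Nat.log 2 n) ^ (C + 2) = (Nat.log 2 n) ^ C * (Nat.log 2 n * Nat.log 2 n) := by ring
  have h25 : 25 ≤ Nat.log 2 n * Nat.log 2 n := by nlinarith
  rw [e]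
  constructor <;> nlinarith

/-- **smooth-win bounds descend to fibrewise-smooth wins at the polylog notch** (defibre, then bound): if every
uniformly smooth win count with tests of degree `(log₂ n)^C` is `≤ θ·2ⁿ` (for every `C`, eventually), then so is every
FIBREWISE-smooth win count with class tests of degree `(log₂ n)^C`. -/
theorem fibre_of_smooth (p : ℕ) [Fact p.Prime] {θ : ℝ}
    (h : ∀ C : ℕ, ∃ n₀ : ℕ, ∀ n ≥ n₀, ∀ c : ℕ, ∀ y : Fin (n + 1) → (Fin n → Bool) → Bool,
      ∀ f : (Fin n → Bool) → Bool,
        (∀ g, HasDegF p (y g) ((Nat.log 2 n) ^ C)) → HasDegF p f ((Nat.log 2 n) ^ C) →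
          ((univ.filter fun u : Fin n → Bool => smoothWin c y f u = true).card : ℝ) ≤ θ * (2 : ℝ) ^ n)
    (C : ℕ) :
    ∃ n₀ : ℕ, ∀ n ≥ n₀, ∀ c : ℕ, ∀ y : Fin (n + 1) → (Fin n → Bool) → Bool,
      ∀ F : Fin 3 → (Fin n → Bool) → Bool,
        (∀ g, HasDegF p (y g) ((Nat.log 2 n) ^ C)) → (∀ j, HasDegF p (F j) ((Nat.log 2 n) ^ C)) →
          ((univ.filter fun u : Fin n → Bool => fibreWin c y F u = true).card : ℝ) ≤ θ * (2 : ℝ) ^ n := by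
  obtain ⟨n₀, hn₀⟩ := h (C + 2)
  refine ⟨max n₀ 32, fun n hn c y F hy hF => ?_⟩
  have hn0 : n₀ ≤ n := le_trans (le_max_left _ _) hn
  have hn32 : 32 ≤ n := le_trans (le_max_right _ _) hn
  have hn1 : 1 ≤ n := by omega
  obtain ⟨hs1, hs2⟩ := polylog_step13 hn32 C
  have hy' : ∀ g, HasDegF p (defib c y F g) ((Nat.log 2 n) ^ (C + 2)) := fun g => by
    have := hasDegF_defib c hy hF g
    unfold HasDegF at this ⊢
    exact lowDeg_mono (by omega) this
  have hf' : HasDegF p (fun v => Bool.xor (Bool.xor (F 0 v) (F 1 v)) (F 2 v)) ((Nat.log 2 n) ^ (C + 2)) := by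
    have := hasDegF_xor3 hF
    unfold HasDegF at this ⊢
    exact lowDeg_mono hs2 this
  have hb := hn₀ n hn0 c (defib c y F) _ hy' hf'
  rw [Finset.filter_congr fun u _ => by rw [smoothWin_defib hn1 c y F u]] at hb
  exact hb

/-- conversely a constant family is a uniform test: fibrewise-smooth win bounds give smooth-win bounds at the same degree. -/
theorem smooth_of_fibre (p : ℕ) [Fact p.Prime] {θ : ℝ} {D : ℕ → ℕ → ℕ} (C : ℕ)
    (h : ∃ n₀ : ℕ, ∀ n ≥ n₀, ∀ c : ℕ, ∀ y : Fin (n + 1) → (Fin n → Bool) → Bool,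
      ∀ F : Fin 3 → (Fin n → Bool) → Bool,
        (∀ g, HasDegF p (y g) ((Nat.log 2 n) ^ C)) → (∀ j, HasDegF p (F j) (D n C)) →
          ((univ.filter fun u : Fin n → Bool => fibreWin c y F u = true).card : ℝ) ≤ θ * (2 : ℝ) ^ n) :
    ∃ n₀ : ℕ, ∀ n ≥ n₀, ∀ c : ℕ, ∀ y : Fin (n + 1) → (Fin n → Bool) → Bool,
      ∀ f : (Fin n → Bool) → Bool,
        (∀ g, HasDegF p (y g) ((Nat.log 2 n) ^ C)) → HasDegF p f (D n C) →
          ((univ.filter fun u : Fin n → Bool => smoothWin c y f u = true).card : ℝ) ≤ θ * (2 : ℝ) ^ n := by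
  obtain ⟨n₀, hn₀⟩ := h
  refine ⟨n₀, fun n hn c y f hy hf => ?_⟩
  have hb := hn₀ n hn c y (fun _ => f) hy (fun _ => hf)
  rw [Finset.filter_congr fun u _ => by rw [fibreWin_const c y f u]] at hb
  exact hb

end Fibre

end Summit.QuantumAdvantage.AdviceFreeQNC0.NullTwist
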